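import Literature.MathematicalPhysics.QuantumFieldTheory.Balaban1983to89.B9Thm33G0DivRAtPins
import Literature.MathematicalPhysics.QuantumFieldTheory.Balaban1983to89.B9GradViaDivLettersAtPinsHolderEps

/-!
# `Balaban1983to89.B9Thm33G0DivRWholeAtPins` — [B9] Theorem 3.3 ∕ 3.12 (pp. 398, 421–423): THE WHOLE DIVERGENCE-LEFT (3.44) SCHEMA `Thm33G0DivR`
# (`D*_U G₀ ∇*_{U,μ}` AND `D*_U G₀ D_U` into `𝔠_W⁽⁰⁾`; the N06 certificate's displayed W-c face `hdiv`) AT THE CERTIFICATE'S PINS IN ONE TERM —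
# both fields, every member, every `Reg335` configuration in small-gauge position, every `ε > 0`

T. Bałaban, *Propagators for lattice gauge theories in a background field*, Commun. Math. Phys. **99** (1985) 389–434
[`Balaban1985BackgroundPropagators`, "B9"]; [4] = T. Bałaban, *Propagators and renormalization transformations for lattice gauge
theories. II*, Commun. Math. Phys. **96** (1984) 223–250 [`Balaban1984PropagatorsII`].

statement-level skeleton of published theorems with citation tags; proofs where landed; nothing here is a claim about the Yang–Mills
mass gap

THE POINT (cell `pub-ymgap`, node N06 [B9]; width seat w5, W-c face `hdiv`).  The stage-11 certificate of record (dag-n06-d, edition 32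
`…N06AtOpsYNuOfRecordV6EPairNM`, l.168–169) displays the hypothesis schema
`hdiv : … → Thm33G0DivR (𝔬12 x) (𝔡A x).Dsd 1 (H x) (fun y => (geo9Y_len_pos x y).le) (bHXA x) (bHX x) BiD BdD δ12₀ δ12₃ U`
(`B9Thm312WholeRightStepFrom3131.Thm33G0DivR`: the two (3.44)-type members of Theorem 3.3 for `G₀ = G(U)` with the divergence `D*_U` on the left —
field `h44Ds μ ε`: `D*_U G₀ ∇*_{U,μ}` from the bond-lattice input Hölder class `bHK … ε` into the sup class `𝔠_W⁽⁰⁾` of scalar site fields, and field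
`h44DsDv ε`: `D*_U G₀ D_U` from the scalar input Hölder class `bHS … ε` into `𝔠_W⁽⁰⁾`).  Its first field was delivered at the pins by this seat
(`B9Thm33G0DivRAtPins.h44Ds_pins`, from the rows-19-derived direction members `Thm33G0Dir` through `D*_U = Σ_ν J†_ν ∘ ∇_{U,ν}`), its second by dag-n06-l
(`B9GradViaDivLettersAtPinsHolderEps.h44DsDv_eps_pins`, from the first through `D_U = Σ_μ ∇*_{U,μ} ∘ J_μ` and the Hölder letter of `J_μ(U)`, every `ε ≥ 0`).
THIS FILE composes the two BY NAME into the member-level form the knit consumes in one term: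
* ★★★ `thm33G0DivR_pins` — at a member `x` of node00-def-Y's record, for Sect.-D letters `𝔬` with the certificate's pin equations (`hblk ∕ hblkW` block maps
  `blkBK bI ∕ blkSK (sIK bI)`, `hDvs ∕ hDv` the coordinate models `DvscoKH ∕ DvcoKH` of `D*_U ∕ D_U`, `hDd ∕ hDds` the single-direction letters `∇_{U,ν} ∕ ∇*_{U,ν}`
  as slice-constant coordinate models, `hbHX ∕ hbHW` the two input Hölder families `bHK bI ∕ bHS (sIK bI)`), `bI` 1-faithful and level-0-based (`hβ1 ∕ hbI0`),
  `U ∈ Reg335` (`SU(N)`-valued), the row-sum letter `hrow` of [4] Lemma 2.1, the ε-indexed transport binder `hΘ` (`t^{−ε}·‖U_μ(s) − U_μ(s′)‖ ≤ ϑ ε` on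
  admissible pairs — the small-gauge position of `U`, dag-n06-l's letter) and ONE analytic input `hH0 : Thm33G0Dir 𝔬 𝔭 Dd Dds 1 H bHX B₀ Bh Bi Bi2 δ₀ U`
  (rows 19's direction members of Theorem 3.3 for `G₀`; in the certificate `= (hG0C x …).1` of `N06G0LayerFromThm310AtPinsE.g0_layer_of_thm310_coreB`):
  `Thm33G0DivR 𝔬 Dds 1 H _ bHX bHW BiD BdD ρ δ₃ U` for ANY constants `BiD ∕ BdD` above the closed letters `(d+1)·(C_J·Bi (min ε 1)·c)` ∕
  `(d+1)·(BiD ε·(1 + 2ϑ ε + 2^ε)·C_J·c)` (`C_J := cR39 (trBasis N)·e^{δ_J·rJ}`) and rates `0 ≤ δ₃ ≤ ρ ≤ δ₀`, `ρ + σ ≤ δ_J`;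
* ★★ `thm33G0DivR_pins_closed` — the same at the closed letters.
KNIT (dag-n06-d, a later edition): `hdiv := fun x hM α₀ hα ha U hU hU' => thm33G0DivR_pins x (hβ1 x) (hbI0 x) hU (hbHXA x) (hbHX x) hrow hc hBi hρ hρ0 hδJ hρJ
hδ₃ hδ₃ρ hϑ (hΘ x U …) (hblk12 x) (hblkW12 x) (hDvsco12 x U) (hDvco12 x U) (h𝔡Ad x U) (h𝔡As x U) hBiD hBdD (hG0C x hM α₀ hα ha U hU hU').1` — the displayed
binder `hdiv` is then replaced by `hΘ` (+ the already displayed `hbI0`), and `BiD ∕ BdD` become letters of `B12₀ ∕ Bi12` after the `obtain`.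

HONEST SCOPE.  By-name composition of two landed helper files (p621802, p623061); nothing of [B9]'s propagator estimates asserted: `Thm33G0Dir` (rows 19's
content) and `hΘ` (a statement about `U`) are HYPOTHESES here; COUNT-NEUTRAL; N06 is NOT discharged; one finite lattice at a time; nothing continuum, nothing
about the mass gap ∕ Clay.  Cell `pub-ymgap` (HUMAN RULING D-0062 ∕ D-0154), Track A node N06 [B9], width seat `pub-ymgap-dag-n06-w5` (g2), 2026-08-28.
-/

noncomputable section

namespace Literature.MathematicalPhysics.QuantumFieldTheory.Balaban1983to89.B9Thm33G0DivRWholeAtPins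

open scoped Matrix.Norms.L2Operator
open Node00 B6GlobalChartV1 B6KLevelCensusIndexV1 B9BackgroundsKLevelV1
open B6Geom246MultiLevelTorus (geomT)
open B6Ineq2142KLevelV1 (β)
open B7Prop2SpecialUnitary (specialUnitaryUnits)
open B9PinMembersKLevelV1 (MemberY geo9Y bg9Y)
open B9CoReadingCoordsTranspose (TrIdx trBasis)
open B9CoReadingCoords (XBK coordOpK cdBₗ cdsBₗ blkBK)
open B9CoReadingCoordsH (XHK)
open B9CoReadingCoordsS (XSK blkSK sIK)
open B9CoReadingCoordsInput (bHK)
open B9CoReadingCoordsInputS (bHS)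
open B9CoRealizesRelAtLetters (RelB)
open B9GeoNormsKLevelV1 (geo9K geo9K_dist_nonneg)
open B9GeoLemma21KLevelV1 (geo9Y_dist_triangle geo9Y_dist_comm geo9Y_len_pos)
open B9Thm39ReadingCoords (cR39 cR39_nonneg)
open B9Thm34Ext (toB6)
open B11SectG (HasMaj BlockNorm RowSum)
open B9Thm312Whole (Ops GeoOK)
open B9Thm312WholeClasses (cNormR)
open B9RWSums343Holder (HolderProbes)
open B9Thm312WholeDir (Thm33G0Dir)
open B9Thm312WholeRightStepFrom3131 (Thm33G0DivR)
open Node00.OpsYSectDCoords (DvscoKH DvcoKH)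
open B9GradViaDivLettersAtPins (rJ)
open B9Thm33G0DivRAtPins (h44Ds_pins)
open B9GradViaDivLettersAtPinsHolderEps (h44DsDv_eps_pins)

variable {d ℓ : ℕ} {hd : 1 ≤ d + 1} {hL : Odd (ℓ + 1) ∧ 1 < ℓ + 1} {b₀ b₁ : ℝ} {Mstar : ℕ} {N : ℕ} [NeZero N]
variable [∀ x : MemberY d ℓ hd hL b₀ b₁ Mstar, Fintype (geo9Y x).Site] [∀ x : MemberY d ℓ hd hL b₀ b₁ Mstar, DecidableRel (RelB x.toKIdx)]

/-- ★★★ **THE WHOLE W-c FACE `hdiv` AT THE CERTIFICATE'S PINS** — `Thm33G0DivR 𝔬 Dds 1 H _ bHX bHW BiD BdD ρ δ₃ U` (both (3.44)-type members of Theorem 3.3 for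
`G₀ = G(U)` with `D*_U` on the left: `D*_U G₀ ∇*_{U,μ}` out of `bHK bI ε` and `D*_U G₀ D_U` out of `bHS (sIK bI) ε`, into `𝔠_W⁽⁰⁾`, every `ε > 0`) from the rows-19
direction members `hH0 : Thm33G0Dir …` (HYPOTHESIS), the transport binder `hΘ` (HYPOTHESIS on `U`) and the pins, for any constants above the closed letters
`(d+1)·(C_J·Bi (min ε 1)·c)` ∕ `(d+1)·(BiD ε·(1 + 2ϑ ε + 2^ε)·C_J·c)`, `C_J = cR39 (trBasis N)·e^{δ_J·rJ}`, and rates `0 ≤ δ₃ ≤ ρ ≤ δ₀`, `ρ + σ ≤ δ_J`: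
first field `B9Thm33G0DivRAtPins.h44Ds_pins` (this seat, g0′), second field dag-n06-l's `B9GradViaDivLettersAtPinsHolderEps.h44DsDv_eps_pins` fed with the first.
[cite: Balaban1985BackgroundPropagators, Thm 3.3 (3.44) p.398 + p.398 (remarks after (3.47)) + (3.3) p.390 + (3.35) p.396 + (3.39)–(3.41) p.397 + Thm 3.12 pp.421–423; Balaban1984PropagatorsII, (2.26) p.228 + (2.51)–(2.56) pp.232–233 + Lemma 2.1 (2.61) p.234 + (2.137) p.247] -/
theorem thm33G0DivR_pins (x : MemberY d ℓ hd hL b₀ b₁ Mstar) {bI : FBondY x.toKIdx → IBondY x.toKIdx}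
    (hβ1 : ∀ f : FBondY x.toKIdx, (geomT x.D).dist (β x.hN x.D x.hk (bI f)) (blkV1 x.hN x.D f) ≤ 1)
    (hbI0 : ∀ f : FBondY x.toKIdx, bI f = bI ⟨f.src, 0⟩)
    {PX PY : Type} [Fintype PX] [Fintype PY]
    {𝔬 : Ops (geo9Y x) (bg9Y (Matrix (Fin N) (Fin N) ℂ) (specialUnitaryUnits (Fin N)) x) (XBK (TrIdx N) x.toKIdx) (XBK (TrIdx N) x.toKIdx)
      (XHK (TrIdx N) x.toKIdx) (XSK (TrIdx N) x.toKIdx)}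
    {𝔭 : HolderProbes (geo9Y x) (bg9Y (Matrix (Fin N) (Fin N) ℂ) (specialUnitaryUnits (Fin N)) x) (XBK (TrIdx N) x.toKIdx) (XBK (TrIdx N) x.toKIdx) PX PY}
    {Dd Dds : (bg9Y (Matrix (Fin N) (Fin N) ℂ) (specialUnitaryUnits (Fin N)) x).Cfg → Fin (d + 1) → Module.End ℝ (XBK (TrIdx N) x.toKIdx → ℝ)}
    {H : Prop} {bHX : ℝ → BlockNorm (toB6 (geo9Y x) 1 H) (XBK (TrIdx N) x.toKIdx → ℝ)} {bHW : ℝ → BlockNorm (toB6 (geo9Y x) 1 H) (XSK (TrIdx N) x.toKIdx → ℝ)}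
    {B₀ : ℝ} {Bh Bi : ℝ → ℝ} {Bi2 : ℝ → ℝ → ℝ} {δ₀ σ c ρ δ₃ δJ c35 α₀ : ℝ} {ϑ BiD BdD : ℝ → ℝ}
    {U : (bg9Y (Matrix (Fin N) (Fin N) ℂ) (specialUnitaryUnits (Fin N)) x).Cfg}
    (hU : (bg9Y (Matrix (Fin N) (Fin N) ℂ) (specialUnitaryUnits (Fin N)) x).Reg335 c35 α₀ U)
    (hbHX : bHX = fun ε => letI : Fintype (geo9K x.toKIdx).Site := (inferInstance : Fintype (geo9Y x).Site); bHK x.toKIdx bI ε)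
    (hbHW : bHW = fun ε => letI : Fintype (geo9K x.toKIdx).Site := (inferInstance : Fintype (geo9Y x).Site); bHS x.toKIdx (sIK x.toKIdx bI) ε)
    (hrow : RowSum (toB6 (geo9Y x) 1 H) σ c) (hc : 0 ≤ c) (hBi : ∀ ε, 0 < ε → ε ≤ 1 → 0 ≤ Bi ε)
    (hρ : 0 ≤ ρ) (hρ0 : ρ ≤ δ₀) (hδJ : 0 ≤ δJ) (hρJ : ρ + σ ≤ δJ) (hδ₃ : 0 ≤ δ₃) (hδ₃ρ : δ₃ ≤ ρ)
    (hϑ : ∀ ε, 0 < ε → 0 ≤ ϑ ε)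
    (hΘ : ∀ ε : ℝ, 0 < ε → ∀ (μ : Fin (d + 1)) (s s' : Site (PV d ℓ x.toKIdx.m x.toKIdx.K hd hL) 0), Adm x.toKIdx ⟨s, μ⟩ ⟨s', μ⟩ →
      tpar x.toKIdx ⟨s, μ⟩ ⟨s', μ⟩ ^ (-ε) * ‖(U μ s : Matrix (Fin N) (Fin N) ℂ) - (U μ s' : Matrix (Fin N) (Fin N) ℂ)‖ ≤ ϑ ε)
    (hblk : 𝔬.blk = blkBK x.toKIdx bI) (hblkW : 𝔬.blkW = blkSK x.toKIdx (sIK x.toKIdx bI))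
    (hDvs : 𝔬.Dvstar U = DvscoKH x.toKIdx (trBasis N) (bg9Y (Matrix (Fin N) (Fin N) ℂ) (specialUnitaryUnits (Fin N)) x) (fun U => U) U)
    (hDv : 𝔬.Dv U = DvcoKH x.toKIdx (trBasis N) (bg9Y (Matrix (Fin N) (Fin N) ℂ) (specialUnitaryUnits (Fin N)) x) (fun U => U) U)
    (hDd : Dd U = fun ν => coordOpK (trBasis N) (fun _ : Fin (d + 1) => cdBₗ x.toKIdx U ν))
    (hDds : Dds U = fun ν => coordOpK (trBasis N) (fun _ : Fin (d + 1) => cdsBₗ x.toKIdx U ν))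
    (hBiD : ∀ ε, 0 < ε → ((d : ℝ) + 1) * (cR39 (trBasis N) * Real.exp (δJ * rJ d ℓ) * Bi (min ε 1) * c) ≤ BiD ε)
    (hBdD : ∀ ε, 0 < ε → ((d : ℝ) + 1) * (BiD ε * ((1 + 2 * ϑ ε + (2 : ℝ) ^ ε) * cR39 (trBasis N) * Real.exp (δJ * rJ d ℓ)) * c) ≤ BdD ε)
    (hH0 : Thm33G0Dir 𝔬 𝔭 Dd Dds 1 H bHX B₀ Bh Bi Bi2 δ₀ U) :
    Thm33G0DivR 𝔬 Dds 1 H (fun y => (geo9Y_len_pos x y).le) bHX bHW BiD BdD ρ δ₃ U := by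
  letI : Fintype (geo9K x.toKIdx).Site := (inferInstance : Fintype (geo9Y x).Site)
  have hG : GeoOK (geo9Y x) := ⟨geo9Y_dist_triangle x, geo9Y_dist_comm x, geo9K_dist_nonneg x.toKIdx, geo9Y_len_pos x⟩
  have hCJ : 0 ≤ cR39 (trBasis N) * Real.exp (δJ * rJ d ℓ) := mul_nonneg (cR39_nonneg _) (Real.exp_nonneg _)
  -- the closed first-field letter is nonnegative
  have hBiD0 : ∀ ε, 0 < ε → 0 ≤ ((d : ℝ) + 1) * (cR39 (trBasis N) * Real.exp (δJ * rJ d ℓ) * Bi (min ε 1) * c) := fun ε hε =>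
    mul_nonneg (by positivity) (mul_nonneg (mul_nonneg hCJ (hBi (min ε 1) (lt_min hε one_pos) (min_le_right _ _))) hc)
  -- FIRST FIELD at the free constant `BiD ε` and rate `ρ`: `h44Ds_pins` (card (Fin (d+1)) = d + 1) + `HasMaj.mono`
  have h1 : ∀ (μ : Fin (d + 1)) (ε : ℝ), 0 < ε →
      HasMaj (bHX ε) (cNormR 1 H 𝔬.blkW (fun y => (geo9Y_len_pos x y).le) 0) (𝔬.Dvstar U ∘ₗ (𝔬.G0 U ∘ₗ Dds U μ))
        (fun a b => BiD ε * Real.exp (-(ρ * (geo9Y x).dist a b))) := by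
    intro μ ε hε
    refine (h44Ds_pins x hβ1 hU hbHX hrow hc hBi hρ hρ0 hδJ hρJ hblk hblkW hDvs hDd hH0 μ ε hε).mono fun a b => ?_
    refine mul_le_mul_of_nonneg_right ?_ (Real.exp_nonneg _)
    rw [Fintype.card_fin, Nat.cast_add, Nat.cast_one]
    exact hBiD ε hε
  refine ⟨h1, fun ε hε => ?_⟩
  -- SECOND FIELD: dag-n06-l's `h44DsDv_eps_pins` fed with the first field at (`BiD ε`, `ρ`), then `HasMaj.mono` up to `BdD ε`
  have hBiDε : 0 ≤ BiD ε := (hBiD0 ε hε).trans (hBiD ε hε)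
  have h1' : ∀ μ : Fin (d + 1), HasMaj (bHK (κ := TrIdx N) (R := (1 : ℝ)) (H := H) x.toKIdx bI ε) (cNormR 1 H 𝔬.blkW hG.lenle 0)
      (𝔬.Dvstar U ∘ₗ (𝔬.G0 U ∘ₗ (fun ν => coordOpK (trBasis N) (fun _ : Fin (d + 1) => cdsBₗ x.toKIdx U ν)) μ))
      (fun a b => BiD ε * Real.exp (-(ρ * (geo9Y x).dist a b))) := by
    intro μ
    have h := h1 μ ε hε
    rw [hbHX, hDds] at h
    exact h
  have h2 := h44DsDv_eps_pins x hβ1 hbI0 hU hε.le (hϑ ε hε) (hΘ ε hε) hG hrow 𝔬 hDv (Dds := fun ν => coordOpK (trBasis N)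
    (fun _ : Fin (d + 1) => cdsBₗ x.toKIdx U ν)) rfl hBiDε hδJ hδ₃ hδ₃ρ (by linarith only [hδ₃ρ, hρJ]) (BdD := BdD ε)
    (by rw [one_mul]; exact hBdD ε hε) h1'
  rw [hbHW]
  exact h2

/-- ★★ **THE WHOLE FACE AT THE CLOSED LETTERS** — `thm33G0DivR_pins` with `BiD ε := (d+1)·(C_J·Bi (min ε 1)·c)` and
`BdD ε := (d+1)·(BiD ε·(1 + 2ϑ ε + 2^ε)·C_J·c)`, `C_J := cR39 (trBasis N)·e^{δ_J·rJ}` (the one-term form with nothing to choose).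
[cite: Balaban1985BackgroundPropagators, Thm 3.3 (3.44) p.398 + p.398 (remarks after (3.47)) + Thm 3.12 pp.421–423; Balaban1984PropagatorsII, (2.26) p.228 + (2.52)–(2.56) pp.232–233 + Lemma 2.1 (2.61) p.234] -/
theorem thm33G0DivR_pins_closed (x : MemberY d ℓ hd hL b₀ b₁ Mstar) {bI : FBondY x.toKIdx → IBondY x.toKIdx}
    (hβ1 : ∀ f : FBondY x.toKIdx, (geomT x.D).dist (β x.hN x.D x.hk (bI f)) (blkV1 x.hN x.D f) ≤ 1)
    (hbI0 : ∀ f : FBondY x.toKIdx, bI f = bI ⟨f.src, 0⟩)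
    {PX PY : Type} [Fintype PX] [Fintype PY]
    {𝔬 : Ops (geo9Y x) (bg9Y (Matrix (Fin N) (Fin N) ℂ) (specialUnitaryUnits (Fin N)) x) (XBK (TrIdx N) x.toKIdx) (XBK (TrIdx N) x.toKIdx)
      (XHK (TrIdx N) x.toKIdx) (XSK (TrIdx N) x.toKIdx)}
    {𝔭 : HolderProbes (geo9Y x) (bg9Y (Matrix (Fin N) (Fin N) ℂ) (specialUnitaryUnits (Fin N)) x) (XBK (TrIdx N) x.toKIdx) (XBK (TrIdx N) x.toKIdx) PX PY}
    {Dd Dds : (bg9Y (Matrix (Fin N) (Fin N) ℂ) (specialUnitaryUnits (Fin N)) x).Cfg → Fin (d + 1) → Module.End ℝ (XBK (TrIdx N) x.toKIdx → ℝ)}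
    {H : Prop} {bHX : ℝ → BlockNorm (toB6 (geo9Y x) 1 H) (XBK (TrIdx N) x.toKIdx → ℝ)} {bHW : ℝ → BlockNorm (toB6 (geo9Y x) 1 H) (XSK (TrIdx N) x.toKIdx → ℝ)}
    {B₀ : ℝ} {Bh Bi : ℝ → ℝ} {Bi2 : ℝ → ℝ → ℝ} {δ₀ σ c ρ δ₃ δJ c35 α₀ : ℝ} {ϑ : ℝ → ℝ}
    {U : (bg9Y (Matrix (Fin N) (Fin N) ℂ) (specialUnitaryUnits (Fin N)) x).Cfg}
    (hU : (bg9Y (Matrix (Fin N) (Fin N) ℂ) (specialUnitaryUnits (Fin N)) x).Reg335 c35 α₀ U)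
    (hbHX : bHX = fun ε => letI : Fintype (geo9K x.toKIdx).Site := (inferInstance : Fintype (geo9Y x).Site); bHK x.toKIdx bI ε)
    (hbHW : bHW = fun ε => letI : Fintype (geo9K x.toKIdx).Site := (inferInstance : Fintype (geo9Y x).Site); bHS x.toKIdx (sIK x.toKIdx bI) ε)
    (hrow : RowSum (toB6 (geo9Y x) 1 H) σ c) (hc : 0 ≤ c) (hBi : ∀ ε, 0 < ε → ε ≤ 1 → 0 ≤ Bi ε)
    (hρ : 0 ≤ ρ) (hρ0 : ρ ≤ δ₀) (hδJ : 0 ≤ δJ) (hρJ : ρ + σ ≤ δJ) (hδ₃ : 0 ≤ δ₃) (hδ₃ρ : δ₃ ≤ ρ)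
    (hϑ : ∀ ε, 0 < ε → 0 ≤ ϑ ε)
    (hΘ : ∀ ε : ℝ, 0 < ε → ∀ (μ : Fin (d + 1)) (s s' : Site (PV d ℓ x.toKIdx.m x.toKIdx.K hd hL) 0), Adm x.toKIdx ⟨s, μ⟩ ⟨s', μ⟩ →
      tpar x.toKIdx ⟨s, μ⟩ ⟨s', μ⟩ ^ (-ε) * ‖(U μ s : Matrix (Fin N) (Fin N) ℂ) - (U μ s' : Matrix (Fin N) (Fin N) ℂ)‖ ≤ ϑ ε)
    (hblk : 𝔬.blk = blkBK x.toKIdx bI) (hblkW : 𝔬.blkW = blkSK x.toKIdx (sIK x.toKIdx bI))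
    (hDvs : 𝔬.Dvstar U = DvscoKH x.toKIdx (trBasis N) (bg9Y (Matrix (Fin N) (Fin N) ℂ) (specialUnitaryUnits (Fin N)) x) (fun U => U) U)
    (hDv : 𝔬.Dv U = DvcoKH x.toKIdx (trBasis N) (bg9Y (Matrix (Fin N) (Fin N) ℂ) (specialUnitaryUnits (Fin N)) x) (fun U => U) U)
    (hDd : Dd U = fun ν => coordOpK (trBasis N) (fun _ : Fin (d + 1) => cdBₗ x.toKIdx U ν))
    (hDds : Dds U = fun ν => coordOpK (trBasis N) (fun _ : Fin (d + 1) => cdsBₗ x.toKIdx U ν))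
    (hH0 : Thm33G0Dir 𝔬 𝔭 Dd Dds 1 H bHX B₀ Bh Bi Bi2 δ₀ U) :
    Thm33G0DivR 𝔬 Dds 1 H (fun y => (geo9Y_len_pos x y).le) bHX bHW
      (fun ε => ((d : ℝ) + 1) * (cR39 (trBasis N) * Real.exp (δJ * rJ d ℓ) * Bi (min ε 1) * c))
      (fun ε => ((d : ℝ) + 1) * ((((d : ℝ) + 1) * (cR39 (trBasis N) * Real.exp (δJ * rJ d ℓ) * Bi (min ε 1) * c)) *
        ((1 + 2 * ϑ ε + (2 : ℝ) ^ ε) * cR39 (trBasis N) * Real.exp (δJ * rJ d ℓ)) * c)) ρ δ₃ U :=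
  thm33G0DivR_pins x hβ1 hbI0 hU hbHX hbHW hrow hc hBi hρ hρ0 hδJ hρJ hδ₃ hδ₃ρ hϑ hΘ hblk hblkW hDvs hDv hDd hDds (fun _ _ => le_rfl)
    (fun _ _ => le_rfl) hH0

end Literature.MathematicalPhysics.QuantumFieldTheory.Balaban1983to89.B9Thm33G0DivRWholeAtPins

end
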